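import Summits.RiemannHypothesis.RiemannHypothesis.Theorems.WeilGroundStateGroundStatesConvergeToXiEnergyUpperTail
import Summits.RiemannHypothesis.RiemannHypothesis.Theorems.WeilGroundStateGroundStatesConvergeToXiEulerLagrange
import Summits.RiemannHypothesis.RiemannHypothesis.Theorems.WeilGroundStateGroundStatesConvergeToXiWeightedL1
import Summits.RiemannHypothesis.RiemannHypothesis.Theorems.WeilGroundStateGroundStatesConvergeToXiTightGeoEnergy
import Summits.RiemannHypothesis.RiemannHypothesis.Theorems.WeilGroundStateGroundStatesConvergeToXiUniformBoundHalf
import Literature.NumberTheory.LFunctions.ZetaZeroReciprocalSum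
import Literature.NumberTheory.LFunctions.WeilMellinBounds
import HarnessLib

/-!
# `WeilGroundState.GroundStatesConvergeToXi` — the OVERLAP–ENERGY inequality (RH-free)
(crux item stmt-RiemannHypothesis-1527, route route-RiemannHypothesis-WeilGroundState; line `Sketch`,
lead c2; `--supports`)

With `φ_a = Φ χ_a` the truncated Riemann kernel (`Φ(t) = 2Ψ(2t)`, `χ_a = Literature.Analysis.Calculus.cutoff a`;
file `…EnergyUpperTail`: at every non-trivial zero `‖φ̂_a(ρ)‖ ≤ D exp(−(π/4)e^{2(a−1)})/(1+γ²)`):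

* `exists_norm_weilFunctional_weilConv_weilReflect_phiCut_le` — for EVERY test `g` and `a ≥ 1`,
  `‖W(g ⋆ φ̃_a)‖ ≤ K exp(−(π/4)e^{2(a−1)}) ∫‖g‖e^{|t|/2}` (explicit formula; only `weilL1 g` enters,
  thanks to `Σ_ρ m(ρ)/(1+γ²) < ∞`), i.e. the truncated kernel nearly annihilates Weil's functional
  against any probe, with a constant insensitive to the smoothness of the probe;
* `exists_abs_weilGroundEnergy_mul_norm_overlap_le` — **for every ground state `u` at a window
  `a ≥ 1`: `|ε(a)| · ‖∫ u conj φ_a‖ ≤ K exp(−(π/4)e^{2(a−1)}) ∫‖u‖e^{|t|/2}`** (weak Euler–Lagrange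
  equation `W(gₙ ⋆ φ̃_a) → ε(a)⟨u, φ_a⟩` along the minimising sequence);
* `…_window` — the same with `e^{a/2} ∫‖c u‖` on the right (the ground state lives on `[−a, a]`).

Reading: either `|ε(a)|` is double-exponentially small or the ground state is nearly ORTHOGONAL to
Riemann's kernel; under `¬RH` (`ε → −∞`) the ground states flee the kernel double-exponentially fast.
Consequence (file `…RHofTightZero`): C⁺ ⇒ RH with NO window-density condition, and every witness of
the crux with bounded renormalised `L¹` mass proves RH.  No new definitions.
-/

noncomputable section

set_option linter.dupNamespace false

open scoped Topology Real ComplexConjugate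
open Filter Set MeasureTheory Complex

namespace Summit.RiemannHypothesis.RiemannHypothesis.Theorems.GroundStatesConvergeToXi

open Literature.NumberTheory.LFunctions


/-! ## The truncated Riemann kernel nearly annihilates the Weil functional against ANY probe -/

/-- **`‖W(g ⋆ φ̃_a)‖ ≤ K exp(−(π/4)e^{2(a−1)}) · ∫‖g‖e^{|t|/2}` for every test `g` and `a ≥ 1`.**
By the explicit formula `W(g ⋆ φ̃_a) = Σ_ρ m(ρ) ĝ(ρ) conj φ̂_a(1−ρ̄)`; `‖ĝ(ρ)‖ ≤ weilL1 g` in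
the strip and `φ̂_a(1−ρ̄)` is the tail transform at a zero of `ξ` (double-exponentially small,
`O(1/(1+γ²))`); `Σ m(ρ)/(1+γ²) < ∞`.  No smoothness of `g` beyond `IsWeilTest` is used in the
bound (only `weilL1 g`), which is what lets it pass to `L²` ground states. [folklore] -/
theorem exists_norm_weilFunctional_weilConv_weilReflect_phiCut_le :
    ∃ K : ℝ, 0 ≤ K ∧ ∀ a : ℝ, 1 ≤ a → ∀ g : ℝ → ℂ, IsWeilTest g →
      ‖weilFunctional (weilConv g (weilReflect (fun t : ℝ => (2 : ℂ) * LagariasMontague.Psic (2 * t) *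
          ((Literature.Analysis.Calculus.cutoff a t : ℝ) : ℂ))))‖ ≤
        K * Real.exp (-(π / 4 * Real.exp (2 * (a - 1)))) * weilL1 g := by
  obtain ⟨D, hD, hZ⟩ := exists_norm_weilMellin_phiCut_zero_le
  -- `Σ_ρ m(ρ)/(1+γ²) < ∞` over the tree's index set (`ZetaZeroSum.summable_zeroOrder_div_one_add_sq`,
  -- whose index set `RHWave0.riemannZetaNontrivialZeros` has the byte-identical body; also landed as
  -- `SelbergDelta.summable_zeroOrder_div_one_add_im_sq`)
  have hZsum : Summable fun ρ : ZetaZeros.riemannZetaNontrivialZeros =>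
      (riemannZetaZeroOrder (ρ : ℂ) : ℝ) / (1 + (ρ : ℂ).im ^ 2) :=
    ZetaZeroSum.summable_zeroOrder_div_one_add_sq
  set Z₁ : ℝ := ∑' ρ : ZetaZeros.riemannZetaNontrivialZeros,
    (riemannZetaZeroOrder (ρ : ℂ) : ℝ) / (1 + (ρ : ℂ).im ^ 2) with hZ₁
  have hZ₁0 : 0 ≤ Z₁ := tsum_nonneg fun ρ => div_nonneg
    (by exact_mod_cast riemannZetaZeroOrder_nonneg (ZetaZeros.riemannZetaNontrivialZeros.ne_one ρ.2))
    (by positivity)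
  refine ⟨D * Z₁, by positivity, fun a ha g hg => ?_⟩
  set φ : ℝ → ℂ := fun t : ℝ => (2 : ℂ) * LagariasMontague.Psic (2 * t) *
    ((Literature.Analysis.Calculus.cutoff a t : ℝ) : ℂ) with hφdef
  set η : ℝ := Real.exp (-(π / 4 * Real.exp (2 * (a - 1)))) with hη
  have hφ : IsWeilTest φ := isWeilTest_phiCut a
  have hφr : IsWeilTest (weilReflect φ) := hφ.weilReflect
  have hk : IsWeilTest (weilConv g (weilReflect φ)) := hg.weilConv hφr
  have hsum := summable_norm_zeroSide hk
  have hW : weilFunctional (weilConv g (weilReflect φ)) = ∑' ρ : ZetaZeros.riemannZetaNontrivialZeros,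
      (riemannZetaZeroOrder (ρ : ℂ) : ℂ) * weilMellin (weilConv g (weilReflect φ)) ρ :=
    tendsto_nhds_unique (explicit_formula_holds hk) (hasWeilZeroSide_tsum hsum)
  have hL : 0 ≤ weilL1 g := weilL1_nonneg g
  have hterm : ∀ ρ : ZetaZeros.riemannZetaNontrivialZeros,
      ‖(riemannZetaZeroOrder (ρ : ℂ) : ℂ) * weilMellin (weilConv g (weilReflect φ)) ρ‖ ≤
        D * η * weilL1 g * ((riemannZetaZeroOrder (ρ : ℂ) : ℝ) / (1 + (ρ : ℂ).im ^ 2)) := by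
    intro ρ
    have hρ := ρ.2
    have hρ' := ZetaZeros.riemannZetaNontrivialZeros.one_sub_conj_mem hρ
    have hm : (0 : ℝ) ≤ riemannZetaZeroOrder (ρ : ℂ) := by
      exact_mod_cast riemannZetaZeroOrder_nonneg (ZetaZeros.riemannZetaNontrivialZeros.ne_one hρ)
    rw [weilMellin_weilConv_holds hg.1.continuous hg.2 hφr.1.continuous hφr.2,
      weilMellin_weilReflect_holds φ ρ, norm_mul, norm_mul, Complex.norm_intCast, abs_of_nonneg hm,
      Complex.norm_conj]
    have hA : ‖weilMellin g ρ‖ ≤ weilL1 g := norm_weilMellin_le_weilL1 hg.1.continuous hg.2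
      (ZetaZeros.riemannZetaNontrivialZeros.re_pos hρ).le (ZetaZeros.riemannZetaNontrivialZeros.re_lt_one hρ).le
    have hB := hZ a ha (1 - conj (ρ : ℂ)) hρ'
    have him : (1 - conj (ρ : ℂ)).im = (ρ : ℂ).im := by simp
    rw [him] at hB
    have hpos : 0 < 1 + (ρ : ℂ).im ^ 2 := by positivity
    calc (riemannZetaZeroOrder (ρ : ℂ) : ℝ) * (‖weilMellin g ρ‖ * ‖weilMellin φ (1 - conj (ρ : ℂ))‖)
        ≤ (riemannZetaZeroOrder (ρ : ℂ) : ℝ) * (weilL1 g * (D * η / (1 + (ρ : ℂ).im ^ 2))) :=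
          mul_le_mul_of_nonneg_left (mul_le_mul hA hB (norm_nonneg _) hL) hm
      _ = D * η * weilL1 g * ((riemannZetaZeroOrder (ρ : ℂ) : ℝ) / (1 + (ρ : ℂ).im ^ 2)) := by
          field_simp
  have hsum' : Summable fun ρ : ZetaZeros.riemannZetaNontrivialZeros =>
      D * η * weilL1 g * ((riemannZetaZeroOrder (ρ : ℂ) : ℝ) / (1 + (ρ : ℂ).im ^ 2)) :=
    hZsum.mul_left _
  rw [hW]
  calc ‖∑' ρ : ZetaZeros.riemannZetaNontrivialZeros,
        (riemannZetaZeroOrder (ρ : ℂ) : ℂ) * weilMellin (weilConv g (weilReflect φ)) ρ‖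
      ≤ ∑' ρ : ZetaZeros.riemannZetaNontrivialZeros,
        ‖(riemannZetaZeroOrder (ρ : ℂ) : ℂ) * weilMellin (weilConv g (weilReflect φ)) ρ‖ :=
        norm_tsum_le_tsum_norm hsum
    _ ≤ ∑' ρ : ZetaZeros.riemannZetaNontrivialZeros,
        D * η * weilL1 g * ((riemannZetaZeroOrder (ρ : ℂ) : ℝ) / (1 + (ρ : ℂ).im ^ 2)) :=
        hsum.tsum_le_tsum hterm hsum'
    _ = D * η * weilL1 g * Z₁ := by rw [tsum_mul_left]
    _ = D * Z₁ * η * weilL1 g := by ring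

/-! ## The overlap–energy inequality for ground states (RH-free) -/

/-- **OVERLAP–ENERGY INEQUALITY (RH-free).**  There is `K ≥ 0` such that for every window `a ≥ 1`
and every ground state `u` of Weil's truncated form (`IsWeilGroundState a u`),
`|ε(a)| · ‖∫ u conj φ_a‖ ≤ K exp(−(π/4)e^{2(a−1)}) ∫ ‖u‖ e^{|t|/2}`,
where `φ_a = Φ χ_a` is the truncated Riemann kernel.  Proof: along the minimising sequence `gₙ → u`
the weak Euler–Lagrange equation gives `W(gₙ ⋆ φ̃_a) → ε(a) ∫ u conj φ_a`
(`IsWeilGroundState.exists_eulerLagrange`), while `‖W(gₙ ⋆ φ̃_a)‖ ≤ K η(a) ∫‖gₙ‖e^{|t|/2}` and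
`∫‖gₙ‖e^{|t|/2} → ∫‖u‖e^{|t|/2}` (`tendsto_integral_norm_mul_exp_of_minimizingSeq`).
Reading: either the ground energy is double-exponentially small in absolute value, or the ground
state is nearly orthogonal to Riemann's kernel — under `¬RH` (`ε(a) → −∞`) the ground states flee
the kernel double-exponentially fast. [folklore] -/
theorem exists_abs_weilGroundEnergy_mul_norm_overlap_le :
    ∃ K : ℝ, 0 ≤ K ∧ ∀ a : ℝ, 1 ≤ a → ∀ u : ℝ → ℂ, IsWeilGroundState a u →
      |weilGroundEnergy a| * ‖∫ t, u t * conj ((2 : ℂ) * LagariasMontague.Psic (2 * t) *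
          ((Literature.Analysis.Calculus.cutoff a t : ℝ) : ℂ))‖ ≤
        K * Real.exp (-(π / 4 * Real.exp (2 * (a - 1)))) * ∫ t, ‖u t‖ * Real.exp (1 / 2 * |t|) := by
  obtain ⟨K, hK, hW⟩ := exists_norm_weilFunctional_weilConv_weilReflect_phiCut_le
  refine ⟨K, hK, fun a ha u hu => ?_⟩
  set φ : ℝ → ℂ := fun t : ℝ => (2 : ℂ) * LagariasMontague.Psic (2 * t) *
    ((Literature.Analysis.Calculus.cutoff a t : ℝ) : ℂ) with hφdef
  set η : ℝ := Real.exp (-(π / 4 * Real.exp (2 * (a - 1)))) with hη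
  obtain ⟨g, hg, hQ, hL, hEL⟩ := hu.exists_eulerLagrange
  have h1 := hEL φ (isWeilTest_phiCut a) (tsupport_phiCut_subset a)
  have h2 : Tendsto (fun n => ∫ t, ‖g n t‖ * Real.exp (1 / 2 * |t|)) atTop
      (𝓝 (∫ t, ‖u t‖ * Real.exp (1 / 2 * |t|))) :=
    tendsto_integral_norm_mul_exp_of_minimizingSeq hu hg hL (1 / 2)
  have h3 : ∀ n, ‖weilFunctional (weilConv (g n) (weilReflect φ))‖ ≤
      K * η * ∫ t, ‖g n t‖ * Real.exp (1 / 2 * |t|) := fun n => by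
    have h := hW a ha (g n) (hg n).1
    rwa [weilL1_eq_integral_half] at h
  have h4 := le_of_tendsto_of_tendsto' h1.norm (h2.const_mul (K * η)) h3
  rw [norm_mul, Complex.norm_real, Real.norm_eq_abs] at h4
  exact h4

/-- **Window form**: `|ε(a)| ‖∫ c u conj φ_a‖ ≤ K exp(−(π/4)e^{2(a−1)}) e^{a/2} ∫‖c u‖` for every
scalar `c` (the ground state vanishes a.e. off `[−a, a]`, where `e^{|t|/2} ≤ e^{a/2}`). [folklore] -/
theorem exists_abs_weilGroundEnergy_mul_norm_overlap_le_window :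
    ∃ K : ℝ, 0 ≤ K ∧ ∀ a : ℝ, 1 ≤ a → ∀ u : ℝ → ℂ, IsWeilGroundState a u → ∀ c : ℂ,
      |weilGroundEnergy a| * ‖c * ∫ t, u t * conj ((2 : ℂ) * LagariasMontague.Psic (2 * t) *
          ((Literature.Analysis.Calculus.cutoff a t : ℝ) : ℂ))‖ ≤
        K * Real.exp (-(π / 4 * Real.exp (2 * (a - 1)))) * Real.exp (a / 2) * ∫ t, ‖c * u t‖ := by
  obtain ⟨K, hK, hO⟩ := exists_abs_weilGroundEnergy_mul_norm_overlap_le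
  refine ⟨K, hK, fun a ha u hu c => ?_⟩
  have h1 := hO a ha u hu
  have h2 := integral_norm_mul_exp_half_le_of_window hu c (b := 0) (by norm_num)
  simp only [zero_mul, Real.exp_zero, mul_one, sub_zero] at h2
  have h3 : ∫ t, ‖c * u t‖ * Real.exp (1 / 2 * |t|) = ‖c‖ * ∫ t, ‖u t‖ * Real.exp (1 / 2 * |t|) := by
    rw [← integral_const_mul]
    refine integral_congr_ae (ae_of_all _ fun t => ?_)
    simp only [norm_mul]; ring
  rw [h3] at h2
  have hη : 0 ≤ Real.exp (-(π / 4 * Real.exp (2 * (a - 1)))) := (Real.exp_pos _).le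
  calc |weilGroundEnergy a| * ‖c * ∫ t, u t * conj ((2 : ℂ) * LagariasMontague.Psic (2 * t) *
          ((Literature.Analysis.Calculus.cutoff a t : ℝ) : ℂ))‖
      = ‖c‖ * (|weilGroundEnergy a| * ‖∫ t, u t * conj ((2 : ℂ) * LagariasMontague.Psic (2 * t) *
          ((Literature.Analysis.Calculus.cutoff a t : ℝ) : ℂ))‖) := by rw [norm_mul]; ring
    _ ≤ ‖c‖ * (K * Real.exp (-(π / 4 * Real.exp (2 * (a - 1)))) * ∫ t, ‖u t‖ * Real.exp (1 / 2 * |t|)) :=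
        mul_le_mul_of_nonneg_left h1 (norm_nonneg c)
    _ = K * Real.exp (-(π / 4 * Real.exp (2 * (a - 1)))) * (‖c‖ * ∫ t, ‖u t‖ * Real.exp (1 / 2 * |t|)) := by
        ring
    _ ≤ K * Real.exp (-(π / 4 * Real.exp (2 * (a - 1)))) * (Real.exp (1 / 2 * a) * ∫ t, ‖c * u t‖) :=
        mul_le_mul_of_nonneg_left h2 (by positivity)
    _ = K * Real.exp (-(π / 4 * Real.exp (2 * (a - 1)))) * Real.exp (a / 2) * ∫ t, ‖c * u t‖ := by
        rw [show (1 : ℝ) / 2 * a = a / 2 by ring]; ring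


/-! ## Small lemmas used by `…RHofTightZero` -/

/-- `exp(a/2 − (π/4)e^{2(a−1)}) → 0` as `a → ∞`. [folklore] -/
theorem tendsto_exp_half_mul_superexp_zero :
    Tendsto (fun a : ℝ => Real.exp (-(π / 4 * Real.exp (2 * (a - 1)))) * Real.exp (a / 2)) atTop (𝓝 0) := by
  have h1 : Tendsto (fun a : ℝ => (π / 2 - 1 / 2) * a - π / 4) atTop atTop :=
    tendsto_atTop_add_const_right _ _ (tendsto_id.const_mul_atTop (by linarith [Real.pi_gt_three]))
  have h2 : Tendsto (fun a : ℝ => π / 4 * Real.exp (2 * (a - 1)) - a / 2) atTop atTop := by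
    refine tendsto_atTop_mono (fun a => ?_) h1
    have := Real.add_one_le_exp (2 * (a - 1))
    nlinarith [Real.pi_gt_three]
  have h3 := Real.tendsto_exp_atBot.comp (tendsto_neg_atTop_atBot.comp h2)
  refine h3.congr fun a => ?_
  simp only [Function.comp_apply, ← Real.exp_add]
  congr 1
  ring

/-- The envelope is decreasing in `|t|`: for `0 ≤ y ≤ x`,
`exp(x/2 − (π/4)e^{2x}) ≤ exp(y/2 − (π/4)e^{2y})`. [folklore] -/
theorem envelope_antitone {x y : ℝ} (hy : 0 ≤ y) (hxy : y ≤ x) :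
    Real.exp (x / 2 - π / 4 * Real.exp (2 * x)) ≤ Real.exp (y / 2 - π / 4 * Real.exp (2 * y)) := by
  rw [Real.exp_le_exp]
  have h1 : Real.exp (2 * y) * (1 + 2 * (x - y)) ≤ Real.exp (2 * x) := by
    have h := Real.add_one_le_exp (2 * (x - y))
    have h' : Real.exp (2 * x) = Real.exp (2 * y) * Real.exp (2 * (x - y)) := by
      rw [← Real.exp_add]; ring_nf
    rw [h']
    exact mul_le_mul_of_nonneg_left (by linarith) (Real.exp_pos _).le
  have h2 : 1 ≤ Real.exp (2 * y) := Real.one_le_exp (by linarith)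
  have h3 : 2 * (x - y) ≤ Real.exp (2 * x) - Real.exp (2 * y) := by nlinarith
  have h4 : π / 4 * (2 * (x - y)) ≤ π / 4 * (Real.exp (2 * x) - Real.exp (2 * y)) :=
    mul_le_mul_of_nonneg_left h3 (by positivity)
  nlinarith [Real.pi_gt_three]

/-- `φ_a` is real-valued: `conj (φ_a t) = φ_a t`. [folklore] -/
theorem conj_phiCut (a t : ℝ) :
    conj ((2 : ℂ) * LagariasMontague.Psic (2 * t) * ((Literature.Analysis.Calculus.cutoff a t : ℝ) : ℂ)) =
      (2 : ℂ) * LagariasMontague.Psic (2 * t) * ((Literature.Analysis.Calculus.cutoff a t : ℝ) : ℂ) := by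
  simp only [map_mul, map_ofNat, LagariasMontague.Psic, Complex.conj_ofReal]

end Summit.RiemannHypothesis.RiemannHypothesis.Theorems.GroundStatesConvergeToXi

end
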